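import Mathlib
import Summits.ValiantsHypothesis.ValiantsHypothesis.Theorems.GeneratorObstructionsPowGenDegreeQPWideAtomsAll

/-!
# Route GeneratorObstructions — crux K2 `PowGenDegreeQP` (stmt-ValiantsHypothesis-11655), line
# `trace-side-regimes`: the wide regime is populated at EVERY intermediate support size

Helper file (`--supports stmt-ValiantsHypothesis-11655`), a corollary of
`GeneratorObstructionsPowGenDegreeQPWideAtomsAll` (unconditional least-constant-weight generator
types of `A(Δ_m[tr X_{n'}^m])`, `n' ≥ 3`) and of the landed upward inheritance in the matrix size
(`SliceTransfer.powFormLex_genType_mono`, GIP17 Prop. 5 + BLMW §5.4):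

* `exists_wide_genType_support` — for `m ≥ 2`, `1 ≤ e' ≤ e` and every final segment
  `ι : MatIdx m → MatIdx (m + e)`, the covariant algebra of `Δ_m[tr X_{m+e}^m]` has a generator type
  `ψ = ext_κ(-k₀·𝟙_{(m+e')²})` (`κ` the final segment of the `(m+e')²` top letters) which is WIDE
  (nonzero off `range ι`), with `m ≤ k₀` and `-|ψ| = k₀ (m+e')²`.

So inside one window cell `(m, e)` the wide regime of `stub_wideGen` carries generator types of
support sizes `(m+1)², (m+2)², …, (m+e)²` and degrees `≥ (m+e')²` respectively — the nullcone-separation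
degrees of ALL the power traces `tr X_{n'}^m`, `m < n' ≤ m + e`, are among the quantities the stub
bounds.  Honest framing: calibration; `stub_wideGen`, K2 remain OPEN; `VP ≠ VNP` untouched.
-/

namespace Summit.ValiantsHypothesis.ValiantsHypothesis.Theorems.GeneratorObstructions.PowGenDegreeQP

open MvPolynomial
open Literature.NumberTheory.DiophantineGeometry Literature.Computability.AlgebraicComplexity
open Summit.ValiantsHypothesis.ValiantsHypothesis.Theses.GeneratorObstructions
open Summit.ValiantsHypothesis.ValiantsHypothesis.Theorems.GenInheritance
open Summit.ValiantsHypothesis.ValiantsHypothesis.Theorems.GeneratorObstructions.SliceTransfer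
open Summit.ValiantsHypothesis.ValiantsHypothesis.Theorems.GeneratorObstructions.PerGenDegreeSuperQP

-- `Summit.ValiantsHypothesis.ValiantsHypothesis.…` is the tree's mandated single-conjunct layout.
set_option linter.dupNamespace false

noncomputable section

/-- **Wide generator types at every intermediate support size.** For `m ≥ 2`, `1 ≤ e' ≤ e` and a
final segment `ι : MatIdx m → MatIdx (m + e)` there are `k₀ ≥ m`, a final segment
`κ : MatIdx (m + e') → MatIdx (m + e)` and the weight `ψ = ext_κ(-k₀·𝟙)` such that `ψ` is a
generator type of `A(Δ_m[tr X_{m+e}^m])` (`γ_ψ ≠ 0`), `ψ` has a nonzero entry off `range ι`, and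
`-|ψ| = k₀ (m+e')²`.  (Least constant weight of `tr X_{m+e'}^m`, `exists_wide_genType` at the cell
`(m, e')`, inherited upward by `powFormLex_genType_mono`.) [cite: GesmundoIkenmeyerPanova2017, Prop. 5] -/
theorem exists_wide_genType_support {m e' e : ℕ} (hm : 2 ≤ m) (he' : 1 ≤ e') (hle : e' ≤ e)
    (ι : MatIdx m → MatIdx (m + e)) :
    ∃ (k₀ : ℕ) (κ : MatIdx (m + e') → MatIdx (m + e)), m ≤ k₀ ∧ StrictMono κ ∧
      IsUpperSet (Set.range κ) ∧
      (∃ x, x ∉ Set.range ι ∧ Function.extend κ (fun _ : MatIdx (m + e') => -(k₀ : ℤ)) 0 x ≠ 0) ∧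
      Module.finrank ℂ (↥(highestWeightSpace (orbitCoordRep (powFormLex ℂ (m + e) m) m)
          (Function.extend κ (fun _ : MatIdx (m + e') => -(k₀ : ℤ)) 0)) ⧸
        Submodule.comap (highestWeightSpace (orbitCoordRep (powFormLex ℂ (m + e) m) m)
          (Function.extend κ (fun _ : MatIdx (m + e') => -(k₀ : ℤ)) 0)).subtype
          (⨆ p : Weight (MatIdx (m + e)) × Weight (MatIdx (m + e)),
            ⨆ (_ : p.1 + p.2 = Function.extend κ (fun _ : MatIdx (m + e') => -(k₀ : ℤ)) 0 ∧
              p.1 ≠ 0 ∧ p.2 ≠ 0),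
            highestWeightSpace (orbitCoordRep (powFormLex ℂ (m + e) m) m) p.1 *
              highestWeightSpace (orbitCoordRep (powFormLex ℂ (m + e) m) m) p.2)) ≠ 0 ∧
      -(Weight.size (Function.extend κ (fun _ : MatIdx (m + e') => -(k₀ : ℤ)) 0)) =
        (k₀ : ℤ) * (((m + e') * (m + e') : ℕ) : ℤ) := by
  classical
  -- the least constant weight of `tr X_{m+e'}^m` (cell `(m, e')`, any final segment `ι₀`)
  obtain ⟨ι₀, -, -⟩ := exists_finalSegment (n := m) (n' := m + e') (Nat.le_add_right m e')
  obtain ⟨k₀, hk₀, hocc, -, -, hγ, hsize⟩ := exists_wide_genType hm he' ι₀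
  -- inherit upward to `m + e`
  obtain ⟨κ, hκ, hκup⟩ := exists_finalSegment (n := m + e') (n' := m + e) (by omega)
  have hγ' := powFormLex_genType_mono (m := m) (n := m + e') (n' := m + e) (by omega) (by omega)
    (by omega) hκ hκup _ hγ
  refine ⟨k₀, κ, hk₀, hκ, hκup, ?_, hγ', ?_⟩
  · -- a letter of `range κ` off `range ι`: `#range κ = (m+e')² > m² = #range ι`
    have hcard : (Finset.univ.image ι).card < (Finset.univ.image κ).card := by
      rw [Finset.card_image_of_injective _ hκ.injective, Finset.card_univ, Fintype.card_lex,
        Fintype.card_prod, Fintype.card_fin]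
      refine lt_of_le_of_lt Finset.card_image_le ?_
      rw [Finset.card_univ, Fintype.card_lex, Fintype.card_prod, Fintype.card_fin]
      nlinarith
    obtain ⟨x, hxκ, hxι⟩ := Finset.exists_mem_notMem_of_card_lt_card hcard
    rw [Finset.mem_image] at hxκ
    obtain ⟨a, -, rfl⟩ := hxκ
    refine ⟨κ a, fun ⟨b, hb⟩ => hxι (Finset.mem_image.mpr ⟨b, Finset.mem_univ _, hb⟩), ?_⟩
    rw [hκ.injective.extend_apply]
    simp only [ne_eq, neg_eq_zero, Nat.cast_eq_zero]
    omega
  · rw [size_extend hκ.injective, hsize]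

end

end Summit.ValiantsHypothesis.ValiantsHypothesis.Theorems.GeneratorObstructions.PowGenDegreeQP
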